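import Summits.CriticalPhenomena.SAWScalingLimit.Theses.SAWLoopFugacityFlow
import Summits.CriticalPhenomena.SAWScalingLimit.Theses.SAWSteinDefect
import Summits.CriticalPhenomena.SAWScalingLimit.Theorems.SAWLoopFugacityFlowAvoidancePassageSandwich
import Literature.Probability.RandomPlanarGeometry.ConformalRestrictionProofs
import Literature.Probability.RandomPlanarGeometry.CritPercSLESimplePathHolds
import Literature.Probability.RandomPlanarGeometry.SimpleCurves
import Literature.Probability.RandomPlanarGeometry.CaratheodoryHalfPlaneProofs
import Literature.Probability.RandomPlanarGeometry.LocalMartingaleProofs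

/-!
# `AvoidancePassage` (item stmt-CriticalPhenomena-4984): the portmanteau sandwich

Closes the support item `AvoidancePassage` of the routes `SAWLoopFugacityFlow` / `SAWSteinDefect`
(`Summit.CriticalPhenomena.SAWScalingLimit.Theses.SAWLoopFugacityFlow.AvoidancePassage`, and verbatim
`…Theses.SAWSteinDefect.AvoidancePassage`, `avoidancePassage_proof_steinDefect`):
if `ν` is the weak limit of the pushed-forward critical SAW laws along `s_n → 0+`, `μ` the chordal
SLE_(8/3) law of `(D; a, b)`, and the SAW avoidance probabilities of EVERY hull subdomain `D''`
converge to `μ(range ⊆ cl D'')`, then `ν(range ⊆ cl D') = μ(range ⊆ cl D')` for every hull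
subdomain `D'`.

* `μ ≤ ν` on the closed event `F = rangeSubset (cl D')` (`CurveClass.isClosed_rangeSubset`):
  portmanteau `limsup Pₙ(F) ≤ ν(F)` (Mathlib, for the laws made probability measures — they are
  probability measures eventually since their masses, `0` or `1`, converge to `ν(univ) = 1`) and
  `Pₙ(F) → μ(F)`.
* `ν ≤ μ`: exhaust `D ∖ cl D'` by compacts `K_k`; the SANDWICH LEMMA
  (`AvoidancePassage.exists_superdomain`, file `…Sandwich`: Newman cross-cuts, Schoenflies charts
  of the bites, carving) gives hull super-domains `D''_k = D ∖ T_k ⊇ D'` (`T_k` closed, off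
  `cl D'`) missing `K_k`; with the open event `G_k = rangeSubset (T_kᶜ) ⊇ F` and
  `G_k ∩ {range ⊆ cl D} ⊆ F_k = rangeSubset (cl D''_k)`: `ν(F) ≤ ν(G_k) ≤ liminf Pₙ(G_k) ≤
  lim (Pₙ(F_k) + Pₙ(range ⊄ cl D)) = μ(F_k)`, and `μ(F_k) → μ(F)` because `μ`-a.e. curve has
  range in `D ∪ {a, b}` (Rohde–Schramm simplicity and Carathéodory, PROVED in the tree:
  `IsSLELaw.ae_simple` / `ae_endpoints` with `ae_isSimpleTrace_sleTrace_of_le_four_holds`,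
  `CurveClass.measurableSet_simple_holds`, `JordanDomain.mapsTo_boundaryExtension_holds`), so a
  curve in infinitely many `F_k ∖ F` would have a point of `D ∖ cl D'`, eventually interior to
  `K_k`, inside `cl D''_k` — impossible.

No named fact is assumed: the theorem is unconditional.
-/

noncomputable section

namespace Summit.CriticalPhenomena.SAWScalingLimit.Theorems

open Set Metric Filter Topology MeasureTheory
open scoped NNReal ENNReal
open Literature.Probability.RandomPlanarGeometry
open Literature.Probability.LatticeModels (Site)

/-- The total mass of the critical SAW law is `0` (no walk, junk) or `1`. [folklore] -/
theorem saw_law_univ_eq_zero_or_one (Ω : Set ℂ) (δ : ℝ) (x y : Site 2) :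
    SAW.law Ω δ x y univ = 0 ∨ SAW.law Ω δ x y univ = 1 := by
  rw [SAW.law, Measure.smul_apply, smul_eq_mul]
  by_cases h0 : SAW.weight Ω δ x y univ = 0
  · left
    rw [h0, mul_zero]
  by_cases ht : SAW.weight Ω δ x y univ = ∞
  · left
    rw [ht, ENNReal.inv_top, zero_mul]
  · right
    exact ENNReal.inv_mul_cancel h0 ht

/-- **`AvoidancePassage` holds** (portmanteau sandwich over carved hull super-domains; see the
module docstring). [folklore] -/
theorem avoidancePassage_proof :
    Summit.CriticalPhenomena.SAWScalingLimit.Theses.SAWLoopFugacityFlow.AvoidancePassage := by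
  intro D a b _ s ν μ _ hν hweak hμ hconv D' hD'sub h0 h1 hεD'
  classical
  haveI : Fact Literature.Probability.Process.isProjectiveLimit_preWienerMeasure :=
    ⟨isProjectiveLimit_preWienerMeasure_holds⟩
  haveI hμP : IsProbabilityMeasure μ := hμ.isProbabilityMeasure
  -- notation
  set P : ℕ → Measure (CurveClass ℂ) := fun n ↦
    (SAW.law D.carrier (s n) (a (s n)) (b (s n))).map (fun γ ↦ γ.curve) with hP
  set F : Set (CurveClass ℂ) := CurveClass.rangeSubset (closure D'.carrier) with hF
  have hFm : MeasurableSet F := CurveClass.measurableSet_rangeSubset isClosed_closure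
  have hmeas : ∀ n, Measurable
      (fun γ : SAW.DomainSAW D.carrier (s n) (a (s n)) (b (s n)) ↦ γ.curve) := fun n ↦
    SAW.DomainSAW.measurable_of_top _
  -- weak convergence of the pushed-forward laws
  have hweakP : ∀ f : BoundedContinuousFunction (CurveClass ℂ) ℝ,
      Tendsto (fun n ↦ ∫ x, f x ∂(P n)) atTop (𝓝 (∫ x, f x ∂ν)) := fun f ↦ by
    have hint : ∀ n, ∫ x, f x ∂(P n) =
        ∫ γ, f γ.curve ∂(SAW.law D.carrier (s n) (a (s n)) (b (s n))) := fun n ↦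
      integral_map (hmeas n).aemeasurable f.continuous.aestronglyMeasurable
    simp only [hint]
    exact hweak f
  -- masses: `0` or `1`, eventually `1`
  have hmass01 : ∀ n, P n univ = 0 ∨ P n univ = 1 := fun n ↦ by
    show ((SAW.law D.carrier (s n) (a (s n)) (b (s n))).map (fun γ ↦ γ.curve)) univ = 0 ∨
      ((SAW.law D.carrier (s n) (a (s n)) (b (s n))).map (fun γ ↦ γ.curve)) univ = 1
    rw [Measure.map_apply (hmeas n) MeasurableSet.univ, preimage_univ]
    exact saw_law_univ_eq_zero_or_one _ _ _ _
  have hmassT : Tendsto (fun n ↦ (P n).real univ) atTop (𝓝 1) := by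
    have h := hweakP (BoundedContinuousFunction.const (CurveClass ℂ) (1 : ℝ))
    simp only [BoundedContinuousFunction.const_apply, integral_const, smul_eq_mul, mul_one,
      probReal_univ] at h
    exact h
  have hevP : ∀ᶠ n in atTop, IsProbabilityMeasure (P n) := by
    have hev : ∀ᶠ n in atTop, (1 / 2 : ℝ) < (P n).real univ :=
      hmassT.eventually (lt_mem_nhds (by norm_num))
    filter_upwards [hev] with n hn
    rcases hmass01 n with h | h
    · exfalso
      rw [measureReal_def, h, ENNReal.toReal_zero] at hn
      linarith
    · exact ⟨h⟩
  -- the laws as probability measures (eventually), and portmanteau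
  let Q : ℕ → ProbabilityMeasure (CurveClass ℂ) := fun n ↦
    if h : IsProbabilityMeasure (P n) then (⟨P n, h⟩ : ProbabilityMeasure (CurveClass ℂ))
    else (⟨ν, hν⟩ : ProbabilityMeasure (CurveClass ℂ))
  have hQP : ∀ᶠ n in atTop, (Q n : Measure (CurveClass ℂ)) = P n := by
    filter_upwards [hevP] with n hn
    simp only [Q, dif_pos hn, ProbabilityMeasure.coe_mk]
  have hQlim : Tendsto Q atTop (𝓝 (⟨ν, hν⟩ : ProbabilityMeasure (CurveClass ℂ))) := by
    rw [ProbabilityMeasure.tendsto_iff_forall_integral_tendsto]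
    intro f
    refine (hweakP f).congr' ?_
    filter_upwards [hQP] with n hn
    rw [hn]
  have hclosed : ∀ C : Set (CurveClass ℂ), IsClosed C →
      limsup (fun n ↦ P n C) atTop ≤ ν C := by
    intro C hC
    have h := ProbabilityMeasure.limsup_measure_closed_le_of_tendsto hQlim hC
    have heq : (fun n ↦ P n C) =ᶠ[atTop] fun n ↦ (Q n : Measure (CurveClass ℂ)) C :=
      hQP.mono fun n hn ↦ by simp only [hn]
    rw [limsup_congr heq]
    exact h
  have hopen : ∀ G : Set (CurveClass ℂ), IsOpen G → ν G ≤ liminf (fun n ↦ P n G) atTop := by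
    intro G hG
    have h := ProbabilityMeasure.le_liminf_measure_open_of_tendsto hQlim hG
    have heq : (fun n ↦ P n G) =ᶠ[atTop] fun n ↦ (Q n : Measure (CurveClass ℂ)) G :=
      hQP.mono fun n hn ↦ by simp only [hn]
    rw [liminf_congr heq]
    exact h
  -- `μ F ≤ ν F`: closed event
  have hlimF : Tendsto (fun n ↦ P n F) atTop (𝓝 (μ F)) := hconv D' hD'sub h0 h1 hεD'
  have hge : μ F ≤ ν F := by
    rw [← hlimF.limsup_eq]
    exact hclosed F (CurveClass.isClosed_rangeSubset isClosed_closure)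
  -- `μ`-a.e. regularity of the SLE(8/3) law
  have hae : ∀ᵐ γ ∂μ, γ.range ⊆ closure D.carrier ∧
      γ.range ∩ frontier D.carrier ⊆ {D.pt 0, D.pt 1} := by
    have h83 : (0 : ℝ≥0) < 8 / 3 := by positivity
    have h83' : ((8 : ℝ≥0) / 3) ≤ 4 := by
      rw [div_le_iff₀ (by norm_num : (0 : ℝ≥0) < 3)]
      norm_num
    filter_upwards [hμ.ae_endpoints JordanDomain.mapsTo_boundaryExtension_holds,
      hμ.ae_simple ae_isSimpleTrace_sleTrace_of_le_four_holds CurveClass.measurableSet_simple_holds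
        h83 h83'] with γ hγ hγ'
    exact ⟨hγ.2.2, hγ'.2⟩
  -- the event `range ⊆ cl D` has full mass, in the limit of the laws too
  set S : Set (CurveClass ℂ) := CurveClass.rangeSubset (closure D.carrier) with hS
  have hSm : MeasurableSet S := CurveClass.measurableSet_rangeSubset isClosed_closure
  have hμS : μ S = 1 := by
    rw [← prob_compl_eq_zero_iff hSm, measure_eq_zero_iff_ae_notMem]
    filter_upwards [hae] with γ hγ
    exact fun h ↦ h hγ.1
  have hlimS : Tendsto (fun n ↦ P n S) atTop (𝓝 1) := by
    have := hconv D Subset.rfl rfl rfl ⟨1, one_pos, rfl, rfl⟩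
    rwa [hμS] at this
  have hlimSc : Tendsto (fun n ↦ P n Sᶜ) atTop (𝓝 0) := by
    have h1 : (fun n ↦ P n Sᶜ) =ᶠ[atTop] fun n ↦ 1 - P n S := by
      filter_upwards [hevP] with n hn
      haveI := hn
      exact prob_compl_eq_one_sub hSm
    rw [tendsto_congr' h1]
    have : Tendsto (fun n ↦ (1 : ℝ≥0∞) - P n S) atTop (𝓝 (1 - 1)) :=
      ENNReal.Tendsto.sub tendsto_const_nhds hlimS (Or.inl ENNReal.one_ne_top)
    simpa using this
  -- exhaustion of `O = D ∖ cl D'` by compacts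
  set O : Set ℂ := D.carrier \ closure D'.carrier with hO
  have hOo : IsOpen O := D.isOpen.sdiff isClosed_closure
  have hOc : (Oᶜ).Nonempty := by
    obtain ⟨z, hz⟩ : (D.carrierᶜ).Nonempty := nonempty_compl.2 D.carrier_ne_univ
    exact ⟨z, fun hzO ↦ hz hzO.1⟩
  set K : ℕ → Set ℂ := fun k ↦ {z | 1 / ((k : ℝ) + 1) ≤ infDist z Oᶜ} with hK
  have hKO : ∀ k, K k ⊆ O := fun k z hz ↦ by
    by_contra hzO
    have hd : infDist z Oᶜ = 0 := infDist_zero_of_mem hzO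
    have hpos : (0 : ℝ) < 1 / ((k : ℝ) + 1) := by positivity
    have hz' : 1 / ((k : ℝ) + 1) ≤ infDist z Oᶜ := hz
    linarith
  have hKc : ∀ k, IsCompact (K k) := fun k ↦
    Metric.isCompact_of_isClosed_isBounded (isClosed_le continuous_const (continuous_infDist_pt _))
      (D.isBounded.subset ((hKO k).trans Set.sdiff_subset))
  have hKint : ∀ z ∈ O, ∃ k₀ : ℕ, ∀ k, k₀ ≤ k → z ∈ interior (K k) := by
    intro z hz
    have hd : 0 < infDist z Oᶜ :=
      (hOo.isClosed_compl.notMem_iff_infDist_pos hOc).1 fun h ↦ h hz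
    obtain ⟨k₀, hk₀⟩ := exists_nat_one_div_lt hd
    refine ⟨k₀, fun k hk ↦ ?_⟩
    have hsub : {w : ℂ | 1 / ((k : ℝ) + 1) < infDist w Oᶜ} ⊆ K k := fun w hw ↦
      show 1 / ((k : ℝ) + 1) ≤ infDist w Oᶜ from le_of_lt hw
    apply interior_mono hsub
    rw [(isOpen_lt continuous_const (continuous_infDist_pt _)).interior_eq]
    show 1 / ((k : ℝ) + 1) < infDist z Oᶜ
    have hk' : (k₀ : ℝ) + 1 ≤ (k : ℝ) + 1 := by exact_mod_cast Nat.add_le_add_right hk 1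
    calc 1 / ((k : ℝ) + 1) ≤ 1 / ((k₀ : ℝ) + 1) := one_div_le_one_div_of_le (by positivity) hk'
      _ < infDist z Oᶜ := hk₀
  -- the carved super-domains
  have hsup : ∀ k, ∃ (E : DobrushinDomain) (T : Set ℂ), IsClosed T ∧
      Disjoint T (closure D'.carrier) ∧ E.carrier = D.carrier \ T ∧ E.pt 0 = D.pt 0 ∧
      E.pt 1 = D.pt 1 ∧ Disjoint E.carrier (K k) := fun k ↦
    AvoidancePassage.exists_superdomain D D' hD'sub h0 h1 (hKc k)
      ((hKO k).trans Set.sdiff_subset) (Set.disjoint_left.2 fun z hz hzc ↦ (hKO k hz).2 hzc)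
  choose E T hTcl hTD' hEcar hE0 hE1 hEK using hsup
  have hptcl : ∀ i, D.pt i ∈ closure D'.carrier := by
    intro i
    fin_cases i
    · exact frontier_subset_closure (h0 ▸ D'.pt_mem_frontier 0)
    · exact frontier_subset_closure (h1 ▸ D'.pt_mem_frontier 1)
  have hptT : ∀ k i, D.pt i ∉ T k := fun k i h ↦ Set.disjoint_left.1 (hTD' k) h (hptcl i)
  set Fk : ℕ → Set (CurveClass ℂ) := fun k ↦ CurveClass.rangeSubset (closure (E k).carrier)
    with hFk
  have hFkm : ∀ k, MeasurableSet (Fk k) := fun k ↦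
    CurveClass.measurableSet_rangeSubset isClosed_closure
  have hadm : ∀ k, Tendsto (fun n ↦ P n (Fk k)) atTop (𝓝 (μ (Fk k))) := fun k ↦
    hconv (E k) (by rw [hEcar k]; exact Set.sdiff_subset) (hE0 k) (hE1 k)
      (AvoidancePassage.exists_ball_inter_eq D (E k) (hTcl k) (hEcar k) (hptT k 0) (hptT k 1))
  -- `ν F ≤ μ F_k` for every `k`
  have hνle : ∀ k, ν F ≤ μ (Fk k) := by
    intro k
    set G : Set (CurveClass ℂ) := CurveClass.rangeSubset (T k)ᶜ with hG
    have hGo : IsOpen G := CurveClass.isOpen_rangeSubset (hTcl k).isOpen_compl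
    have hFG : F ⊆ G := fun γ hγ ↦ (show γ.range ⊆ closure D'.carrier from hγ).trans
      fun z hz hzT ↦ Set.disjoint_left.1 (hTD' k) hzT hz
    have hGS : G ∩ S ⊆ Fk k := by
      rintro γ ⟨hγG, hγS⟩
      show γ.range ⊆ closure (E k).carrier
      rw [hEcar k]
      intro z hz
      have h' : z ∈ closure D.carrier ∩ (T k)ᶜ := ⟨hγS hz, hγG hz⟩
      exact (hTcl k).isOpen_compl.closure_inter h'
    calc ν F ≤ ν G := measure_mono hFG
      _ ≤ liminf (fun n ↦ P n G) atTop := hopen G hGo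
      _ ≤ liminf (fun n ↦ P n (Fk k) + P n Sᶜ) atTop := by
          refine liminf_le_liminf (Eventually.of_forall fun n ↦ ?_)
          calc P n G ≤ P n (G ∩ S ∪ Sᶜ) := measure_mono fun γ hγ ↦ by
                  by_cases h : γ ∈ S
                  · exact Or.inl ⟨hγ, h⟩
                  · exact Or.inr h
            _ ≤ P n (G ∩ S) + P n Sᶜ := measure_union_le _ _
            _ ≤ P n (Fk k) + P n Sᶜ := add_le_add (measure_mono hGS) le_rfl
      _ = μ (Fk k) := by
          have := (hadm k).add hlimSc
          rw [add_zero] at this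
          exact this.liminf_eq
  -- `μ F_k → μ F`: the limsup of the differences is `μ`-null
  set A : ℕ → Set (CurveClass ℂ) := fun k ↦ ⋃ j, ⋃ (_ : k ≤ j), (Fk j \ F) with hA
  have hAm : ∀ k, MeasurableSet (A k) := fun k ↦
    MeasurableSet.iUnion fun j ↦ MeasurableSet.iUnion fun _ ↦ (hFkm j).diff hFm
  have hAanti : Antitone A := fun j k hjk ↦ iUnion₂_subset fun i hi ↦
    subset_iUnion₂ (s := fun i (_ : j ≤ i) ↦ Fk i \ F) i (hjk.trans hi)
  have hAnull : μ (⋂ k, A k) = 0 := by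
    refine measure_mono_null ?_ (ae_iff.1 hae)
    intro γ hγ hgood
    obtain ⟨hγD, hγfr⟩ := hgood
    obtain ⟨j₀, -, hγj₀⟩ := mem_iUnion₂.1 (mem_iInter.1 hγ 0)
    have hγF : γ ∉ F := hγj₀.2
    obtain ⟨z, hz, hzD'⟩ : ∃ z ∈ γ.range, z ∉ closure D'.carrier := by
      by_contra h
      push Not at h
      exact hγF h
    have hzD : z ∈ D.carrier := by
      have hzcl := hγD hz
      rw [closure_eq_self_union_frontier] at hzcl
      rcases hzcl with h | h
      · exact h
      · exfalso
        have hmem : z ∈ ({D.pt 0, D.pt 1} : Set ℂ) := hγfr ⟨hz, h⟩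
        rcases hmem with h' | h'
        · exact hzD' (h' ▸ hptcl 0)
        · exact hzD' (h' ▸ hptcl 1)
    obtain ⟨k₀, hk₀⟩ := hKint z ⟨hzD, hzD'⟩
    obtain ⟨j, hj, hγj⟩ := mem_iUnion₂.1 (mem_iInter.1 hγ k₀)
    have hzint : z ∈ interior (K j) := hk₀ j hj
    have hzE : z ∈ closure (E j).carrier := hγj.1 hz
    have hdis : Disjoint (closure (E j).carrier) (interior (K j)) :=
      ((hEK j).mono_right interior_subset).closure_left isOpen_interior
    exact Set.disjoint_left.1 hdis hzE hzint
  have hAlim : Tendsto (fun k ↦ μ (A k)) atTop (𝓝 0) := by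
    have := tendsto_measure_iInter_atTop (μ := μ) (fun k ↦ (hAm k).nullMeasurableSet) hAanti
      ⟨0, measure_ne_top μ _⟩
    rw [hAnull] at this
    exact this
  have hle : ν F ≤ μ F := by
    have hbound : ∀ k, ν F ≤ μ F + μ (A k) := fun k ↦
      calc ν F ≤ μ (Fk k) := hνle k
        _ ≤ μ (F ∪ A k) := measure_mono fun γ hγ ↦ by
            by_cases h : γ ∈ F
            · exact Or.inl h
            · exact Or.inr (mem_iUnion₂.2 ⟨k, le_rfl, hγ, h⟩)
        _ ≤ μ F + μ (A k) := measure_union_le _ _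
    have hT : Tendsto (fun k ↦ μ F + μ (A k)) atTop (𝓝 (μ F + 0)) :=
      tendsto_const_nhds.add hAlim
    rw [add_zero] at hT
    exact ge_of_tendsto' hT hbound
  exact le_antisymm hle hge

/-- **`AvoidancePassage` of the sibling route `SAWSteinDefect`** (the item is shared verbatim by
the two routes): the same theorem. [folklore] -/
theorem avoidancePassage_proof_steinDefect :
    Summit.CriticalPhenomena.SAWScalingLimit.Theses.SAWSteinDefect.AvoidancePassage :=
  avoidancePassage_proof

end Summit.CriticalPhenomena.SAWScalingLimit.Theorems

end
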